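/-
Copyright (c) 2026 the pub-hodgecm-mathlib formalisation cell (harness21).  Prover seat hodgecm-mathlib-LH4-p06 (g8), Track A «(D-RAM) FOUR-FRAME» squad, helper lane on h413 =
stmt-HodgeConjecture-24833 (count-neutral; dealer∕pen LH4-plan (g14) WORD #130, LH7-p08 (g0) division 21:50:13Z).  β-BOARD v1 row R8 ∕ (P5) «H `(2ρ,2ρ,2ρ)`», FILE 5d: the
labelled-odd TABLE VALUE of the core-hanging stratum for the SHALLOW key `(m, m, L)`, `2 ≤ L − m ≤ 2d − 4`, is ZERO in every slot — ★ p861984's binder `hZ₃`.  2026-09-04.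
-/
import Summits.HodgeConjecture.HodgeConjecture.Theorems.F0P3cDyRamLabelledOddCoreHangingOrbitTheta      -- ★ (LH7-p07 (g0), FILE 5d′): `finsum_orbit_labelledOdd_div_relIndex_eq_of_theta`; brings ★ p862119 FILE 4c′ (orbit engine letters), ★ 5a∕5b∕5b′, ★ FILE 1, ★ κH-B2, ★ tokens, ★ parity
import Summits.HodgeConjecture.HodgeConjecture.Theorems.F0P3cDyRamAdmissibleShiftedCharacterSums       -- ★ p862049 (LH7-p08 (g0), FILE 4b): `v_add_admissible`, `sum_normSign_add_eq_zero`, `sum_normSign_mul_normSign_add_eq_zero`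
import Summits.HodgeConjecture.HodgeConjecture.Theorems.F0P3cDyRamAdmissibleSubBreakCharacterSum       -- ★ p862332 (LH7-p08 (g0), FILE 5c): `v_towerSign_sub_eq_of_sub`, `sum_normSign_one_add_mul_normSign_add_eq_zero_of_subBreak`
import HarnessLib

/-!
# Crux `H413`, line LH4 «(D-RAM) FOUR-FRAME» — (β) table, β-BOARD row R8 ∕ (P5), FILE 5d: «THE H ROW FOR THE SHALLOW KEY `(m, m, L)`, `2 ≤ L − m ≤ 2d − 4`, IS ZERO» —
# `Σᶠ_{M ∈ H(ρ), clean shell} m^Λ_i(M)∕[𝒰 : N S̃(M)] = 0` at `2ρ + ℓ₀ = m`, every slot `i` (★ p861984 `hangingValue_of_rows`' binder `hZ₃`; ★ p862244 `hRest_of_heads`' schema `hZ`)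

Cell `hodgecm-mathlib` (D-0151), FLOOR 0, crux item H413 = `stmt-HodgeConjecture-24833`, route `HCCMUnconditional`; squad F0∕P3c∕LH4.  THEOREMS ONLY (no `def`, no instance, no
notation, no `sorry`, default heartbeats); ★-only imports; lane `--supports stmt-HodgeConjecture-24833 --as helper` (count-neutral); pays NO row, states NO law.

THE MATHEMATICS (LH7-p08 (g0) H-ROW DERIVATION v1 §3∕§4 + MATH NOTE 21:33:39Z + CRIB 008a4659, key `(m, m, L)`, SHALLOW `s := L − m`, `2 ≤ s ≤ 2d − 4`: the term of §4 is `0`).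
Below the boundary the two depth-`m` tokens satisfy `|e_B − e_A| = |ϖ|^s` EXACTLY (★ 5c §0 `v_towerSign_sub_eq_of_sub`), so with `g_α = π₀^ρ e_A`, `g_β = π₀^ρ e_B`, `c = e_B∕e_A`,
`|c − 1| = |ϖ|^s < 1`: for every admissible `g` (`|g| = |1+g| = 1`) the letters of ★ 5d′ hold — `G := g·g_α + g_β = π₀^ρ e_A (g + c) ≠ 0`, `|π₀|^2·|g_α| ≤ |ϖ|^{2d−1}|G|` (`2ρ ≥ 2d − 1`),
`|g_β − g_α| = |π₀|^ρ|ϖ|^s ≤ |G|`, `|G + (g_β − g_α)| = |G − g(g_β − g_α)| = |G|` — and ★ 5d′ `finsum_orbit_labelledOdd_div_relIndex_eq_of_theta` gives the orbit value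
`vec(g)_i∕2 · mass`, `vec(g) = (ω(g)·ε·ι, ε·ι, ω(−(1+g))·ε·J)`, `ε = ω(G) = ω(e_A)ω(g + c)`, `ι = [2d−1 ≤ ρ]`, and the near bracket `J = [|ϖ|^ρ|g_β − g_α| ≤ |ϖ|^{2d−1}|G|] = [2d − 1 ≤ ρ + s]`
(g-INDEPENDENT).  Summing over the admissible classes `g ∈ S` (★ B7 (iv) (C), ★ (iv-c)):
* slots 0, 1: `ι·ω(e_A)·Σ_g ω(g)ω(g + c) = 0`, `ι·ω(e_A)·Σ_g ω(g + c) = 0` — ★ FILE 4b's shifted sums in the alive window `2d − 1 ≤ ρ` (they ask only `|c − 1| < 1`), the dead bracket otherwise;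
* slot 2: `J·ω(−1)ω(e_A)·Σ_g ω(1+g)ω(g+c)`; in the window `2d − 1 ≤ ρ + s` the sum is ★ 5c §2 `sum_normSign_one_add_mul_normSign_add_eq_zero_of_subBreak` (`1 ≤ s < 2d − 2`) `= 0`, off it `J = 0`.
  (At the boundary `s = 2d − 2` this slot did NOT vanish — ★ p862216; the flip of ★ 5c §1 needs `s < 2d − 2`: that is the whole difference.)
* HEAD §1 `finsum_stratum_H_shell_labelledOdd_div_relIndex_eq_zero_of_shallow₃` (★ p862216's binder list VERBATIM with `hbdry` ↦ `h13 hsh`, RHS `0`); SCHEMA §2 `shallow₃_zero_schema` =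
  ★ p862244 `hRest_of_heads`' 4th binder `hZ` VERBATIM (∀-closed, token-free, `N₀ = n0DerivedOfRecord d`; the tokens come from ★ `exists_towerSign_of_mcOfRecord_le`).
HONEST LABEL.  Count-neutral (`--supports`); the shallow twins `(m,L,m)`∕`(L,m,m)` are ★ p862207's transports (chair), `hRest`, (T3), (β-BAL), (β), T₊ stay OPEN; `HC_CM` is proved only
modulo the 7 printed citations (2 remaining named inputs: hLiu418 = `stmt-HodgeConjecture-24832`, h413 = `stmt-HodgeConjecture-24833`) until rung 0 closes.

## References
* [Kottwitz1986BaseChangeUnits] R. E. Kottwitz, *Base change for unit elements of Hecke algebras*, Compositio Math. 60 (1986), §1 pp. 240–241 (signed lattice counts modulo the torus).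
* [LanglandsShelstad1987] R. P. Langlands, D. Shelstad, *On the definition of transfer factors*, Math. Ann. 278 (1987), §3.
* [Rogawski1990] J. D. Rogawski, *Automorphic Representations of Unitary Groups in Three Variables*, Ann. of Math. Stud. 123 (1990), §4.9 Prop. 4.9.1 (a)(b) p. 55, §4.10 p. 58.
* [Serre1979] J.-P. Serre, *Local Fields*, GTM 67 (1979), Ch. V §3 Cor. 3, Ch. XV §2 (the conductor; the break `U^{(d−1)}∕U^{(d)}`).
-/

set_option autoImplicit false

noncomputable section

namespace Summit.HodgeConjecture.HodgeConjecture.Cruxes.H413.F0P3cDyRamLabelledOddCoreHangingShallowSum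

open Matrix WithZero
open Literature.NumberTheory.Automorphic Literature.NumberTheory.Automorphic.HermitianLattice Literature.NumberTheory.Automorphic.UnitaryGroup
open Literature.NumberTheory.Automorphic.UnitaryLatticeTree Literature.NumberTheory.Automorphic.UnitaryThreeFourFrame
open Literature.NumberTheory.LocalFields Literature.NumberTheory.LocalFields.WildQuadraticDatum
open Summit.HodgeConjecture.HodgeConjecture.Cruxes.H413.F0P3cDyRamFourFramePieces
open Summit.HodgeConjecture.HodgeConjecture.Cruxes.H413.F0P3cDyRamFourFrameCensusDefs
open Summit.HodgeConjecture.HodgeConjecture.Cruxes.H413.F0P3cDyRamStageOneBDefs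
open Summit.HodgeConjecture.HodgeConjecture.Cruxes.H413.F0P3cDyRamStageOneBDerivedDefs (n0DerivedOfRecord mcOfRecord_le_n0DerivedOfRecord)
open Summit.HodgeConjecture.HodgeConjecture.Cruxes.H413.F0P3cDyRamDiagonalTorusDefs
open Summit.HodgeConjecture.HodgeConjecture.Cruxes.H413.F0P3cDyRamDiagonalStrataDefs
open Summit.HodgeConjecture.HodgeConjecture.Cruxes.H413.F0P3cDyRamLabelledOddCountDefs
open Summit.HodgeConjecture.HodgeConjecture.Cruxes.H413.F0P3cDyRamLabelledOddCoreHangingOrbitTheta (finsum_orbit_labelledOdd_div_relIndex_eq_of_theta)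
open Summit.HodgeConjecture.HodgeConjecture.Cruxes.H413.F0P3cDyRamAdmissibleShiftedCharacterSums (v_add_admissible sum_normSign_add_eq_zero sum_normSign_mul_normSign_add_eq_zero)
open Summit.HodgeConjecture.HodgeConjecture.Cruxes.H413.F0P3cDyRamAdmissibleSubBreakCharacterSum (v_towerSign_sub_eq_of_sub sum_normSign_one_add_mul_normSign_add_eq_zero_of_subBreak)
open Summit.HodgeConjecture.HodgeConjecture.Cruxes.H413.F0P3cDyRamDiagonalKappaCoreHangingCharacterMaps (v_add_eq_one_of_lt)
open Summit.HodgeConjecture.HodgeConjecture.Cruxes.H413.F0P3cDyRamLabelledOddCoreHangingShell (shell_iff_of_mem_stratum_H finsum_stratum_H_shell_eq_of_eq)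
open Summit.HodgeConjecture.HodgeConjecture.Cruxes.H413.F0P3cDyRamDiagonalCoreHangingSocket (stratum_H_eq)
open Summit.HodgeConjecture.HodgeConjecture.Cruxes.H413.F0P3cDyRamDiagonalCoreHangingCount (coreHangingStratum_eq_iUnion_orbits pairwise_disjoint_orbits)
open Summit.HodgeConjecture.HodgeConjecture.Cruxes.H413.F0P3cDyRamDiagonalGluedClassRepresentatives (exists_fixed_class_representatives)
open Summit.HodgeConjecture.HodgeConjecture.Cruxes.H413.F0P3cDyRamDiagonalGluedStabiliserIndex (ne_zero_and_v_lt_one_of_v_eq_exp)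
open Summit.HodgeConjecture.HodgeConjecture.Cruxes.H413.F0P3cDyRamDiagonalKappaCoreHangingSocket (finite_orbit)
open Summit.HodgeConjecture.HodgeConjecture.Cruxes.H413.F0P3cDyRamDiagonalCoreHangingPolarisationExplicit (normSign_mul_norm')
open Summit.HodgeConjecture.HodgeConjecture.Cruxes.H413.F0P3cDyRamStableCountTypeZero (v_diag_eq_one)
open Summit.HodgeConjecture.HodgeConjecture.Cruxes.H413.F0P3cDyRamDiagonalKappaCoreHangingClass (two_le_d_of_v_two_lt_one)
open Summit.HodgeConjecture.HodgeConjecture.Cruxes.H413.F0P3cDyRamElementDatumParity (depth_mod_two_eq_of_isElementDatum)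
open Summit.HodgeConjecture.HodgeConjecture.Cruxes.H413.F0P3cDyRamTowerSignToken (exists_towerSign_of_mcOfRecord_le)
open scoped Valued WithZero Matrix MatrixGroups

variable {K : Type} [Field K] [Valued K ℤᵐ⁰]

/-! ## §1  HEAD — the H row for the shallow key `(m, m, L)`, `2 ≤ L − m ≤ 2d − 4`, is zero -/

/-- **THE H ROW, SHALLOW KEY `(m, m, L)` (`n₁ = n₂ = m < n₃ = L`, `L + 4 ≤ m + 2d`), AT `2ρ + ℓ₀ = m`, IS ZERO.**  Ramified datum on a complete field with finite residue field, `|2| < 1`;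
element datum with `mcOfRecord d ≤ N₀`; `T = diag(α, β, 1)`; tower-sign tokens `e_A` of `α − 1` (depth `n₂`) and `e_B` of `β − 1` (depth `n₁`) — ★ p862216's `heA`∕`heB` VERBATIM.  Then for
every slot `i`:  `Σᶠ_{M ∈ stratum σ ϖ T (2ρ,2ρ,2ρ), clean shell} labelledOddCount σ ϖ 0 i Λ M ∕ [𝒰 : N(S̃′(M))] = 0` (`Λ = valueClassLabel σ ϖ (α−1) (β−1) m* d`): orbit by orbit
(★ 5d′) the value is `(ω(g)ει, ει, ω(−(1+g))εJ)∕2·mass` with `ε = ω(e_A)ω(g + e_B∕e_A)`, `ι = [2d−1 ≤ ρ]`, `J = [2d−1 ≤ ρ + (L−m)]`; slots 0∕1 are ★ FILE 4b's shifted sums (alive) or the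
dead bracket, slot 2 is ★ 5c §2's sub-break sum (window `J = 1`) or the bracket `J = 0` — ★ p861984's `hZ₃`.
[cite: Kottwitz1986BaseChangeUnits, §1 pp. 240–241] [cite: LanglandsShelstad1987, §3] [cite: Rogawski1990, §4.9 Prop. 4.9.1 (a)(b) p. 55, §4.10 p. 58] [cite: Serre1979, Ch. XV §2] -/
theorem finsum_stratum_H_shell_labelledOdd_div_relIndex_eq_zero_of_shallow₃ [CompleteSpace K] [Finite 𝓀[K]] {σ : K →+* K} {ϖ : K} {d t : ℕ}
    (hD : IsRamifiedQuadraticDatum σ ϖ d t) (h2 : Valued.v (2 : K) < 1)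
    {α β : K} {N₀ n₁ n₂ n₃ : ℕ} (hE : IsElementDatum σ ϖ N₀ α β n₁ n₂ n₃) (hmc : mcOfRecord d ≤ N₀) (h12 : n₁ = n₂) (h13 : n₁ < n₃) (hsh : n₃ + 4 ≤ n₁ + 2 * d)
    (T : GL (Fin 3) K) (hT : (T : Matrix (Fin 3) (Fin 3) K) = Matrix.diagonal ![α, β, 1]) (ρ : ℕ) (hρ : 1 ≤ ρ) (h2ρ : 2 * ρ + d % 2 = n₁)
    {eA eB : K} (hσeA : σ eA = eA) (heA1 : Valued.v eA = 1) (hσeB : σ eB = eB)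
    (heA : Valued.v ((ϖ ^ mstarOfRecord d)⁻¹ * ((α - 1) * ((ϖ * σ ϖ) ^ ((n₂ - d % 2) / 2))⁻¹ - eA * ((ϖ - σ ϖ) * ((ϖ * σ ϖ) ^ ((d - d % 2) / 2))⁻¹))) ≤ 1)
    (heB : Valued.v ((ϖ ^ mstarOfRecord d)⁻¹ * ((β - 1) * ((ϖ * σ ϖ) ^ ((n₁ - d % 2) / 2))⁻¹ - eB * ((ϖ - σ ϖ) * ((ϖ * σ ϖ) ^ ((d - d % 2) / 2))⁻¹))) ≤ 1)
    (i : Fin 3) :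
    ∑ᶠ M ∈ {M : Submodule 𝒪[K] (Fin 3 → K) | M ∈ stratum σ ϖ T ![2 * ρ, 2 * ρ, 2 * ρ] ∧
        (LatticeInLevel ϖ (d % 2) (Matrix.diagonal ![α - 1, β - 1, 0]) M ∧ ¬ LatticeInLevel ϖ (d % 2 + 1) (Matrix.diagonal ![α - 1, β - 1, 0]) M ∧
          LatticeInLevel ϖ (mcOfRecord d) (Matrix.diagonal ![(α - 1) * (α - 1), (β - 1) * (β - 1), 0]) M)},
      (labelledOddCount σ ϖ 0 i (valueClassLabel σ ϖ (α - 1) (β - 1) (mstarOfRecord d) d) M : ℚ) /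
        ((((unitStabilizer M).map (unitNormMap σ 3)).relIndex (fixedUnitTorus σ 3) : ℕ) : ℚ) = 0 := by
  classical
  have hTr := trace_bound_of_isRamifiedQuadraticDatum hD h2
  obtain ⟨hσ, hvσ, hϖ, hfix, hd, hd1, -⟩ := id hD
  obtain ⟨hϖ0, hϖ1⟩ := ne_zero_and_v_lt_one_of_v_eq_exp hϖ
  have hvϖ0 : Valued.v ϖ ≠ 0 := (Valuation.ne_zero_iff _).2 hϖ0
  have hvϖpos : 0 < Valued.v ϖ := (Valuation.pos_iff _).2 hϖ0
  have h2d : 2 ≤ d := two_le_d_of_v_two_lt_one hD h2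
  have hσϖ0 : σ ϖ ≠ 0 := (map_ne_zero σ).2 hϖ0
  have hπ0 : ((ϖ * σ ϖ) ^ ρ : K) ≠ 0 := pow_ne_zero _ (mul_ne_zero hϖ0 hσϖ0)
  have hvπ : 0 < Valued.v ((ϖ * σ ϖ) ^ ρ) := (Valuation.pos_iff _).2 hπ0
  have hvPϖ : Valued.v ((ϖ * σ ϖ) ^ ρ) = Valued.v ϖ ^ (2 * ρ) := by rw [map_pow, map_mul, hvσ, ← pow_two, ← pow_mul]
  have hpρ : Valued.v ϖ ^ ρ < 1 := pow_lt_one₀ zero_le hϖ1 (by omega)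
  -- element letters
  have hα1 : Valued.v α = 1 := (v_diag_eq_one hvσ hE) 0
  have hβ1 : Valued.v β = 1 := (v_diag_eq_one hvσ hE) 1
  have h₁ : Valued.v (β - 1) = Valued.v ϖ ^ n₁ := hE.2.2.2.2.2.1
  have h₂ : Valued.v (α - 1) = Valued.v ϖ ^ n₂ := hE.2.2.2.2.2.2.1
  have h₃ : Valued.v (β - α) = Valued.v ϖ ^ n₃ := by rw [Valuation.map_sub_swap]; exact hE.2.2.2.2.2.2.2.1
  have hn₁ : N₀ ≤ n₁ := hE.2.2.2.2.2.2.2.2.1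
  -- numerics of the letters
  have hmcv : mcOfRecord d = 2 * ((d % 2 + 2 * d - 1 + d) / 2) := rfl
  have hmsv : mstarOfRecord d = d % 2 + 2 * d - 1 := rfl
  have hℓN : d % 2 + 1 ≤ N₀ := by rw [hmcv] at hmc; omega
  have hmN : d % 2 + 2 * d - 1 ≤ N₀ := by rw [hmcv] at hmc; omega
  have hℓmc : 2 * (d % 2) + 1 ≤ mcOfRecord d := by rw [hmcv]; omega
  have hmmc : d % 2 + 2 * d - 1 + d % 2 ≤ mcOfRecord d := by rw [hmcv]; omega
  have hneq : ¬ (n₁ = n₂ ∧ n₂ = n₃) := fun h => by omega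
  have h2ρmin : 2 * ρ + d % 2 = min n₁ n₂ := by omega
  have h2ρ' : 2 * d - 1 ≤ 2 * ρ := by rw [hmcv] at hmc; omega
  have hρ₁ : 2 * ρ ≤ n₁ := by omega
  have hρ₂ : 2 * ρ ≤ n₂ := by omega
  have hρ₃ : ρ ≤ n₃ := by omega
  have hkα : (n₂ - d % 2) / 2 = ρ := by omega
  have hkβ : (n₁ - d % 2) / 2 = ρ := by omega
  -- the shallow window `s := n₃ − n₁`, `1 ≤ s < 2d − 2`
  have hs1 : 1 ≤ n₃ - n₁ := by omega
  have hsd : n₃ - n₁ < 2 * d - 2 := by omega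
  -- §0: the EXACT shallow letter `|e_A − e_B| = |ϖ|^s` (★ 5c §0)
  have hpar : n₂ % 2 = d % 2 := by omega
  have heB' : Valued.v ((ϖ ^ mstarOfRecord d)⁻¹ * ((β - 1) * ((ϖ * σ ϖ) ^ ((n₂ - d % 2) / 2))⁻¹ - eB * ((ϖ - σ ϖ) * ((ϖ * σ ϖ) ^ ((d - d % 2) / 2))⁻¹))) ≤ 1 := by
    rw [← h12]; exact heB
  have hδE : Valued.v (eA - eB) = Valued.v ϖ ^ (n₃ - n₁) :=
    v_towerSign_sub_eq_of_sub hD (L := n₃) (n := n₂) (s := n₃ - n₁) h₃ (by omega) (by omega) (by omega) hpar heA heB'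
  rw [hkα] at heA
  rw [hkβ] at heB
  -- `e_B` is a unit, `c := e_B ∕ e_A` has `|c − 1| = |ϖ|^s < 1`
  have heA0 : eA ≠ 0 := fun h => by rw [h, map_zero] at heA1; exact zero_ne_one heA1
  have hδ1 : Valued.v ϖ ^ (n₃ - n₁) < 1 := pow_lt_one₀ zero_le hϖ1 (by omega)
  have heB1 : Valued.v eB = 1 := by
    rw [show eB = eA + -(eA - eB) by ring]; exact v_add_eq_one_of_lt heA1 (by rw [Valuation.map_neg, hδE]; exact hδ1)
  have heB0 : eB ≠ 0 := fun h => by rw [h, map_zero] at heB1; exact zero_ne_one heB1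
  have hσc : σ (eB / eA) = eB / eA := by rw [map_div₀, hσeA, hσeB]
  have hvδ : Valued.v (eB / eA - 1) = Valued.v ϖ ^ (n₃ - n₁) := by
    rw [div_sub_one heA0, map_div₀, heA1, div_one, Valuation.map_sub_swap, hδE]
  have hc1 : Valued.v (eB / eA - 1) < 1 := by rw [hvδ]; exact hδ1
  -- the approximants `g_α = π₀^ρ e_A`, `g_β = π₀^ρ e_B` and their letters
  have hσπ : σ ((ϖ * σ ϖ) ^ ρ) = (ϖ * σ ϖ) ^ ρ := by rw [map_pow, map_mul, hσ, mul_comm]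
  have hσgα : σ ((ϖ * σ ϖ) ^ ρ * eA) = (ϖ * σ ϖ) ^ ρ * eA := by rw [map_mul, hσπ, hσeA]
  have hσgβ : σ ((ϖ * σ ϖ) ^ ρ * eB) = (ϖ * σ ϖ) ^ ρ * eB := by rw [map_mul, hσπ, hσeB]
  have hrew : ∀ x e : K, ((ϖ * σ ϖ) ^ ρ)⁻¹ * (x - (ϖ * σ ϖ) ^ ρ * e * ((ϖ - σ ϖ) * ((ϖ * σ ϖ) ^ ((d - d % 2) / 2))⁻¹)) =
      x * ((ϖ * σ ϖ) ^ ρ)⁻¹ - e * ((ϖ - σ ϖ) * ((ϖ * σ ϖ) ^ ((d - d % 2) / 2))⁻¹) := fun x e => by field_simp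
  have hgα : Valued.v ((ϖ ^ (d % 2 + 2 * d - 1))⁻¹ * (((ϖ * σ ϖ) ^ ρ)⁻¹ * ((α - 1) - (ϖ * σ ϖ) ^ ρ * eA * ((ϖ - σ ϖ) * ((ϖ * σ ϖ) ^ ((d - d % 2) / 2))⁻¹)))) ≤ 1 := by
    rw [hrew, ← hmsv]; exact heA
  have hgβ : Valued.v ((ϖ ^ (d % 2 + 2 * d - 1))⁻¹ * (((ϖ * σ ϖ) ^ ρ)⁻¹ * ((β - 1) - (ϖ * σ ϖ) ^ ρ * eB * ((ϖ - σ ϖ) * ((ϖ * σ ϖ) ^ ((d - d % 2) / 2))⁻¹)))) ≤ 1 := by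
    rw [hrew, ← hmsv]; exact heB
  -- ★ 5d′'s letters for every admissible `g`, `ε(g) = ω(e_A)·ω(g + c)`, and the near bracket `J = [2d − 1 ≤ ρ + s]` (g-independent)
  have hG : ∀ g : K, σ g = g → Valued.v g = 1 → Valued.v (1 + g) = 1 →
      g * ((ϖ * σ ϖ) ^ ρ * eA) + (ϖ * σ ϖ) ^ ρ * eB ≠ 0 ∧
      Valued.v ϖ ^ (2 * ρ) * Valued.v ((ϖ * σ ϖ) ^ ρ * eA) ≤ Valued.v ϖ ^ (2 * d - 1) * Valued.v (g * ((ϖ * σ ϖ) ^ ρ * eA) + (ϖ * σ ϖ) ^ ρ * eB) ∧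
      Valued.v ((ϖ * σ ϖ) ^ ρ * eB - (ϖ * σ ϖ) ^ ρ * eA) ≤ Valued.v (g * ((ϖ * σ ϖ) ^ ρ * eA) + (ϖ * σ ϖ) ^ ρ * eB) ∧
      Valued.v (g * ((ϖ * σ ϖ) ^ ρ * eA) + (ϖ * σ ϖ) ^ ρ * eB + ((ϖ * σ ϖ) ^ ρ * eB - (ϖ * σ ϖ) ^ ρ * eA)) = Valued.v (g * ((ϖ * σ ϖ) ^ ρ * eA) + (ϖ * σ ϖ) ^ ρ * eB) ∧
      Valued.v (g * ((ϖ * σ ϖ) ^ ρ * eA) + (ϖ * σ ϖ) ^ ρ * eB - g * ((ϖ * σ ϖ) ^ ρ * eB - (ϖ * σ ϖ) ^ ρ * eA)) = Valued.v (g * ((ϖ * σ ϖ) ^ ρ * eA) + (ϖ * σ ϖ) ^ ρ * eB) ∧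
      normSign σ (g * ((ϖ * σ ϖ) ^ ρ * eA) + (ϖ * σ ϖ) ^ ρ * eB) = normSign σ eA * normSign σ (g + eB / eA) ∧
      (Valued.v ϖ ^ ρ * Valued.v ((ϖ * σ ϖ) ^ ρ * eB - (ϖ * σ ϖ) ^ ρ * eA) ≤ Valued.v ϖ ^ (2 * d - 1) * Valued.v (g * ((ϖ * σ ϖ) ^ ρ * eA) + (ϖ * σ ϖ) ^ ρ * eB) ↔
        2 * d - 1 ≤ ρ + (n₃ - n₁)) := by
    intro g hσg hvg h1g
    obtain ⟨hgc, -⟩ := v_add_admissible h2 hvg h1g hc1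
    have hgc0 : g + eB / eA ≠ 0 := fun h => by rw [h, map_zero] at hgc; exact zero_ne_one hgc
    have hfacG : g * ((ϖ * σ ϖ) ^ ρ * eA) + (ϖ * σ ϖ) ^ ρ * eB = (ϖ * σ ϖ) ^ ρ * (eA * (g + eB / eA)) := by field_simp
    have hvG : Valued.v (g * ((ϖ * σ ϖ) ^ ρ * eA) + (ϖ * σ ϖ) ^ ρ * eB) = Valued.v ((ϖ * σ ϖ) ^ ρ) := by
      rw [hfacG, map_mul, map_mul, heA1, hgc, mul_one, mul_one]
    have hvgα : Valued.v ((ϖ * σ ϖ) ^ ρ * eA) = Valued.v ((ϖ * σ ϖ) ^ ρ) := by rw [map_mul, heA1, mul_one]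
    have hvb : Valued.v ((ϖ * σ ϖ) ^ ρ * eB - (ϖ * σ ϖ) ^ ρ * eA) = Valued.v ((ϖ * σ ϖ) ^ ρ) * Valued.v ϖ ^ (n₃ - n₁) := by
      rw [← mul_sub, map_mul, Valuation.map_sub_swap, hδE]
    have h1mg : Valued.v (1 - g) = 1 := by
      rw [show (1 : K) - g = (1 + g) + -(2 * g) by ring]
      exact v_add_eq_one_of_lt h1g (by rw [Valuation.map_neg, map_mul, hvg, mul_one]; exact h2)
    refine ⟨fun h => by rw [h, map_zero] at hvG; exact hvπ.ne hvG, ?_, ?_, ?_, ?_, ?_, ?_⟩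
    · rw [hvgα, hvG]
      exact mul_le_mul' (pow_le_pow_right_of_le_one' hϖ1.le h2ρ') le_rfl
    · rw [hvb, hvG]
      calc Valued.v ((ϖ * σ ϖ) ^ ρ) * Valued.v ϖ ^ (n₃ - n₁) ≤ Valued.v ((ϖ * σ ϖ) ^ ρ) * 1 := mul_le_mul' le_rfl hδ1.le
        _ = Valued.v ((ϖ * σ ϖ) ^ ρ) := mul_one _
    · rw [hvG, show g * ((ϖ * σ ϖ) ^ ρ * eA) + (ϖ * σ ϖ) ^ ρ * eB + ((ϖ * σ ϖ) ^ ρ * eB - (ϖ * σ ϖ) ^ ρ * eA) =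
          (ϖ * σ ϖ) ^ ρ * (eA * ((g + eB / eA) + (eB / eA - 1))) by field_simp,
        map_mul, map_mul, heA1, v_add_eq_one_of_lt hgc hc1, mul_one, mul_one]
    · rw [hvG, show g * ((ϖ * σ ϖ) ^ ρ * eA) + (ϖ * σ ϖ) ^ ρ * eB - g * ((ϖ * σ ϖ) ^ ρ * eB - (ϖ * σ ϖ) ^ ρ * eA) =
          (ϖ * σ ϖ) ^ ρ * (eB * (1 - g) + 2 * g * eA) by ring, map_mul,
        v_add_eq_one_of_lt (by rw [map_mul, heB1, h1mg, mul_one]) (by rw [map_mul, map_mul, hvg, heA1, mul_one, mul_one]; exact h2), mul_one]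
    · rw [hfacG, show (ϖ * σ ϖ) ^ ρ * (eA * (g + eB / eA)) = ϖ ^ ρ * σ (ϖ ^ ρ) * (eA * (g + eB / eA)) by rw [map_pow, ← mul_pow],
        normSign_mul_norm' σ _ (pow_ne_zero _ hϖ0), normSign_mul_of_fixed hD hσeA (by rw [map_add, hσg, hσc]) heA0 hgc0]
    · rw [hvb, hvG, hvPϖ, show Valued.v ϖ ^ ρ * (Valued.v ϖ ^ (2 * ρ) * Valued.v ϖ ^ (n₃ - n₁)) = Valued.v ϖ ^ (3 * ρ + (n₃ - n₁)) by
          rw [← pow_add, ← pow_add]; congr 1; omega,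
        ← pow_add, pow_le_pow_iff_right_of_lt_one₀ hvϖpos hϖ1]
      omega
  -- the shell keeps the whole stratum (★ FILE 1), the stratum is the frame set (★ B7), decomposed into orbits (★ (C))
  rw [finsum_stratum_H_shell_eq_of_eq hD hE hmc hneq T ρ hρ h2ρmin, stratum_H_eq hvσ hfix hϖ T hρ, hmsv]
  obtain ⟨R, hRfin, hRcard, hR1, hR2, hR3⟩ := exists_fixed_class_representatives hσ hvσ hfix hϖ hd ρ 0 hρ
  simp only [Nat.mul_zero, pow_zero, Nat.add_zero] at hR1 hR2 hR3
  have hRadmfin : {g : K | g ∈ R ∧ Valued.v (1 + g) = 1}.Finite := hRfin.subset (Set.sep_subset _ _)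
  have hunion := coreHangingStratum_eq_iUnion_orbits hσ hvσ hϖ hTr T hT hα1 hβ1 h₁ h₂ h₃ hρ hρ₁ hρ₂ hρ₃ hR1 hR2
  have horb : ∀ g ∈ {g : K | g ∈ R ∧ Valued.v (1 + g) = 1}, ∀ M ∈ {M : Submodule 𝒪[K] (Fin 3 → K) | ∃ u ∈ unitTorus K 3,
        M = mapGL (diagGLUnits u) (latt (!![1, 0, 0; 1, ϖ ^ ρ, 0; 1 * 1 + g, ϖ ^ ρ * 1, ϖ ^ (2 * ρ)] : Matrix (Fin 3) (Fin 3) K))},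
      M ∈ normalisedStableLattices T ∧
        LatticeInLevel ϖ (d % 2) (Matrix.diagonal ![α - 1, β - 1, 0]) M ∧ ¬ LatticeInLevel ϖ (d % 2 + 1) (Matrix.diagonal ![α - 1, β - 1, 0]) M ∧
          LatticeInLevel ϖ (mcOfRecord d) (Matrix.diagonal ![(α - 1) * (α - 1), (β - 1) * (β - 1), 0]) M := by
    intro g hg M hM
    have hframe : M ∈ {M : Submodule 𝒪[K] (Fin 3 → K) | M ∈ normalisedStableLattices T ∧ IsDualisableLattice σ ϖ M ∧
        ∃ x ζ y'' : K, Valued.v x = 1 ∧ Valued.v ζ = 1 ∧ Valued.v y'' = 1 ∧ Valued.v (x * ζ + y'') = 1 ∧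
          M = latt (!![1, 0, 0; x, ϖ ^ ρ, 0; x * ζ + y'', ϖ ^ ρ * ζ, ϖ ^ (2 * ρ)] : Matrix (Fin 3) (Fin 3) K)} := by
      rw [hunion]; exact Set.mem_biUnion hg hM
    have hstr : M ∈ stratum σ ϖ T ![2 * ρ, 2 * ρ, 2 * ρ] := by rw [stratum_H_eq hvσ hfix hϖ T hρ]; exact hframe
    exact ⟨hframe.1, (shell_iff_of_mem_stratum_H hD hE hmc hneq T hρ M hstr).2 h2ρmin⟩
  rw [hunion, finsum_mem_biUnion (pairwise_disjoint_orbits hϖ ρ (fun g hg => (hR1 g hg).2) hR3) hRadmfin (fun g hg => finite_orbit hϖ hρ (hR1 _ hg.1).2),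
    finsum_mem_congr rfl (fun g hg => finsum_orbit_labelledOdd_div_relIndex_eq_of_theta hD h2 hρ (hR1 _ hg.1).1 (hR1 _ hg.1).2 hg.2 hE hℓN hmN hℓmc hmmc hT
      (horb g hg) hσgα hσgβ (hG g (hR1 _ hg.1).1 (hR1 _ hg.1).2 hg.2).1 (hG g (hR1 _ hg.1).1 (hR1 _ hg.1).2 hg.2).2.1 (hG g (hR1 _ hg.1).1 (hR1 _ hg.1).2 hg.2).2.2.1
      (fun _ => (hG g (hR1 _ hg.1).1 (hR1 _ hg.1).2 hg.2).2.2.2.1) (fun _ => (hG g (hR1 _ hg.1).1 (hR1 _ hg.1).2 hg.2).2.2.2.2.1) hgα hgβ i)]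
  -- the orbit mass (g-independent common factor)
  set mass : ℚ := ((((Nat.card 𝓀[K] - 1) * Nat.card 𝓀[K] ^ (ρ - 1)) * ((Nat.card 𝓀[K] - 1) * Nat.card 𝓀[K] ^ (2 * ρ - 1)) : ℕ) : ℚ) *
    ((((Nat.card 𝓀[K] - 1) * Nat.card 𝓀[K] ^ ((ρ + 1) / 2 - 1)) * ((Nat.card 𝓀[K] - 1) * Nat.card 𝓀[K] ^ (ρ - 1)) : ℕ) : ℚ)⁻¹ with hmass
  clear_value mass
  -- the admissible classes as a Finset system `S` (★ κH (B1a) letters)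
  rw [finsum_mem_eq_finite_toFinset_sum _ hRadmfin]
  set S := hRadmfin.toFinset with hSdef
  have hmem : ∀ g, g ∈ S ↔ g ∈ R ∧ Valued.v (1 + g) = 1 := fun g => Set.Finite.mem_toFinset hRadmfin
  have hS1 : ∀ g ∈ S, σ g = g ∧ Valued.v g = 1 ∧ Valued.v (1 + g) = 1 := fun g hg =>
    ⟨(hR1 g ((hmem g).1 hg).1).1, (hR1 g ((hmem g).1 hg).1).2, ((hmem g).1 hg).2⟩
  have hS2 : ∀ f : K, σ f = f → Valued.v f = 1 → Valued.v (1 + f) = 1 → ∃ g ∈ S, Valued.v (f - g) ≤ Valued.v ϖ ^ ρ := by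
    intro f hσf hf h1f
    obtain ⟨g, hgR, hfg⟩ := hR2 f hσf hf
    refine ⟨g, (hmem g).2 ⟨hgR, ?_⟩, hfg⟩
    rw [show 1 + g = (1 + f) + -(f - g) by ring]
    exact v_add_eq_one_of_lt h1f (by rw [Valuation.map_neg]; exact hfg.trans_lt hpρ)
  have hS3 : ∀ g ∈ S, ∀ g' ∈ S, Valued.v (g - g') ≤ Valued.v ϖ ^ ρ → g = g' :=
    fun g hg g' hg' h => hR3 g ((hmem g).1 hg).1 g' ((hmem g').1 hg').1 h
  have hε : ∀ g ∈ S, normSign σ (g * ((ϖ * σ ϖ) ^ ρ * eA) + (ϖ * σ ϖ) ^ ρ * eB) = normSign σ eA * normSign σ (g + eB / eA) := fun g hg =>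
    (hG g (hS1 g hg).1 (hS1 g hg).2.1 (hS1 g hg).2.2).2.2.2.2.2.1
  have hJ : ∀ g ∈ S, (Valued.v ϖ ^ ρ * Valued.v ((ϖ * σ ϖ) ^ ρ * eB - (ϖ * σ ϖ) ^ ρ * eA) ≤
      Valued.v ϖ ^ (2 * d - 1) * Valued.v (g * ((ϖ * σ ϖ) ^ ρ * eA) + (ϖ * σ ϖ) ^ ρ * eB) ↔ 2 * d - 1 ≤ ρ + (n₃ - n₁)) := fun g hg =>
    (hG g (hS1 g hg).1 (hS1 g hg).2.1 (hS1 g hg).2.2).2.2.2.2.2.2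
  fin_cases i
  · -- slot 0: `ι·ω(e_A)·Σ_g ω(g)ω(g + c)·mass∕2 = 0` (★ FILE 4b)
    simp only [Fin.zero_eta]
    by_cases hal : 2 * d - 1 ≤ ρ
    · have hterm : ∀ g ∈ S, (((![normSign σ g * normSign σ (g * ((ϖ * σ ϖ) ^ ρ * eA) + (ϖ * σ ϖ) ^ ρ * eB) * (if 2 * d - 1 ≤ ρ then 1 else 0),
             normSign σ (g * ((ϖ * σ ϖ) ^ ρ * eA) + (ϖ * σ ϖ) ^ ρ * eB) * (if 2 * d - 1 ≤ ρ then 1 else 0),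
             normSign σ (-(1 + g)) * normSign σ (g * ((ϖ * σ ϖ) ^ ρ * eA) + (ϖ * σ ϖ) ^ ρ * eB) *
               (if Valued.v ϖ ^ ρ * Valued.v ((ϖ * σ ϖ) ^ ρ * eB - (ϖ * σ ϖ) ^ ρ * eA) ≤
                   Valued.v ϖ ^ (2 * d - 1) * Valued.v (g * ((ϖ * σ ϖ) ^ ρ * eA) + (ϖ * σ ϖ) ^ ρ * eB) then 1 else 0)] : Fin 3 → ℤ) 0 : ℤ) : ℚ) / 2 * mass =
          ((normSign σ eA : ℤ) : ℚ) / 2 * mass * ((normSign σ g * normSign σ (g + eB / eA) : ℤ) : ℚ) := by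
        intro g hg
        simp only [cons_val_zero, if_pos hal, mul_one, hε g hg]
        push_cast; ring
      rw [Finset.sum_congr rfl hterm, ← Finset.mul_sum, ← Int.cast_sum, sum_normSign_mul_normSign_add_eq_zero hD h2 hal hσc hc1 S hS1 hS2 hS3]
      simp
    · have hterm : ∀ g ∈ S, (((![normSign σ g * normSign σ (g * ((ϖ * σ ϖ) ^ ρ * eA) + (ϖ * σ ϖ) ^ ρ * eB) * (if 2 * d - 1 ≤ ρ then 1 else 0),
             normSign σ (g * ((ϖ * σ ϖ) ^ ρ * eA) + (ϖ * σ ϖ) ^ ρ * eB) * (if 2 * d - 1 ≤ ρ then 1 else 0),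
             normSign σ (-(1 + g)) * normSign σ (g * ((ϖ * σ ϖ) ^ ρ * eA) + (ϖ * σ ϖ) ^ ρ * eB) *
               (if Valued.v ϖ ^ ρ * Valued.v ((ϖ * σ ϖ) ^ ρ * eB - (ϖ * σ ϖ) ^ ρ * eA) ≤
                   Valued.v ϖ ^ (2 * d - 1) * Valued.v (g * ((ϖ * σ ϖ) ^ ρ * eA) + (ϖ * σ ϖ) ^ ρ * eB) then 1 else 0)] : Fin 3 → ℤ) 0 : ℤ) : ℚ) / 2 * mass = 0 := by
        intro g _
        simp only [cons_val_zero, if_neg hal, mul_zero, Int.cast_zero, zero_div, zero_mul]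
      rw [Finset.sum_congr rfl hterm]
      simp
  · -- slot 1: `ι·ω(e_A)·Σ_g ω(g + c)·mass∕2 = 0` (★ FILE 4b)
    simp only [Fin.mk_one]
    by_cases hal : 2 * d - 1 ≤ ρ
    · have hterm : ∀ g ∈ S, (((![normSign σ g * normSign σ (g * ((ϖ * σ ϖ) ^ ρ * eA) + (ϖ * σ ϖ) ^ ρ * eB) * (if 2 * d - 1 ≤ ρ then 1 else 0),
             normSign σ (g * ((ϖ * σ ϖ) ^ ρ * eA) + (ϖ * σ ϖ) ^ ρ * eB) * (if 2 * d - 1 ≤ ρ then 1 else 0),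
             normSign σ (-(1 + g)) * normSign σ (g * ((ϖ * σ ϖ) ^ ρ * eA) + (ϖ * σ ϖ) ^ ρ * eB) *
               (if Valued.v ϖ ^ ρ * Valued.v ((ϖ * σ ϖ) ^ ρ * eB - (ϖ * σ ϖ) ^ ρ * eA) ≤
                   Valued.v ϖ ^ (2 * d - 1) * Valued.v (g * ((ϖ * σ ϖ) ^ ρ * eA) + (ϖ * σ ϖ) ^ ρ * eB) then 1 else 0)] : Fin 3 → ℤ) 1 : ℤ) : ℚ) / 2 * mass =
          ((normSign σ eA : ℤ) : ℚ) / 2 * mass * ((normSign σ (g + eB / eA) : ℤ) : ℚ) := by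
        intro g hg
        simp only [cons_val_one, cons_val_zero, if_pos hal, mul_one, hε g hg]
        push_cast; ring
      rw [Finset.sum_congr rfl hterm, ← Finset.mul_sum, ← Int.cast_sum, sum_normSign_add_eq_zero hD h2 hal hσc hc1 S hS1 hS2 hS3]
      simp
    · have hterm : ∀ g ∈ S, (((![normSign σ g * normSign σ (g * ((ϖ * σ ϖ) ^ ρ * eA) + (ϖ * σ ϖ) ^ ρ * eB) * (if 2 * d - 1 ≤ ρ then 1 else 0),
             normSign σ (g * ((ϖ * σ ϖ) ^ ρ * eA) + (ϖ * σ ϖ) ^ ρ * eB) * (if 2 * d - 1 ≤ ρ then 1 else 0),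
             normSign σ (-(1 + g)) * normSign σ (g * ((ϖ * σ ϖ) ^ ρ * eA) + (ϖ * σ ϖ) ^ ρ * eB) *
               (if Valued.v ϖ ^ ρ * Valued.v ((ϖ * σ ϖ) ^ ρ * eB - (ϖ * σ ϖ) ^ ρ * eA) ≤
                   Valued.v ϖ ^ (2 * d - 1) * Valued.v (g * ((ϖ * σ ϖ) ^ ρ * eA) + (ϖ * σ ϖ) ^ ρ * eB) then 1 else 0)] : Fin 3 → ℤ) 1 : ℤ) : ℚ) / 2 * mass = 0 := by
        intro g _
        simp only [cons_val_one, cons_val_zero, if_neg hal, mul_zero, Int.cast_zero, zero_div, zero_mul]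
      rw [Finset.sum_congr rfl hterm]
      simp
  · -- slot 2: `J·ω(−1)ω(e_A)·Σ_g ω(1+g)ω(g+c)·mass∕2`; in the window `J = 1` the sum is ★ 5c §2, off it the bracket is `0`
    simp only [Fin.reduceFinMk]
    have hωneg : ∀ g ∈ S, normSign σ (-(1 + g)) = normSign σ (-1 : K) * normSign σ (1 + g) := fun g hg => by
      have h1g0 : 1 + g ≠ 0 := fun h => by have := (hS1 g hg).2.2; rw [h, map_zero] at this; exact zero_ne_one this
      rw [← normSign_mul_of_fixed hD (by rw [map_neg, map_one]) (by rw [map_add, map_one, (hS1 g hg).1]) (neg_ne_zero.2 one_ne_zero) h1g0, neg_one_mul]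
    by_cases hwin : 2 * d - 1 ≤ ρ + (n₃ - n₁)
    · have hterm : ∀ g ∈ S, (((![normSign σ g * normSign σ (g * ((ϖ * σ ϖ) ^ ρ * eA) + (ϖ * σ ϖ) ^ ρ * eB) * (if 2 * d - 1 ≤ ρ then 1 else 0),
             normSign σ (g * ((ϖ * σ ϖ) ^ ρ * eA) + (ϖ * σ ϖ) ^ ρ * eB) * (if 2 * d - 1 ≤ ρ then 1 else 0),
             normSign σ (-(1 + g)) * normSign σ (g * ((ϖ * σ ϖ) ^ ρ * eA) + (ϖ * σ ϖ) ^ ρ * eB) *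
               (if Valued.v ϖ ^ ρ * Valued.v ((ϖ * σ ϖ) ^ ρ * eB - (ϖ * σ ϖ) ^ ρ * eA) ≤
                   Valued.v ϖ ^ (2 * d - 1) * Valued.v (g * ((ϖ * σ ϖ) ^ ρ * eA) + (ϖ * σ ϖ) ^ ρ * eB) then 1 else 0)] : Fin 3 → ℤ) 2 : ℤ) : ℚ) / 2 * mass =
          ((normSign σ (-1 : K) * normSign σ eA : ℤ) : ℚ) / 2 * mass * ((normSign σ (1 + g) * normSign σ (g + eB / eA) : ℤ) : ℚ) := by
        intro g hg
        simp only [cons_val_two, Nat.succ_eq_add_one, Nat.reduceAdd, tail_cons, head_cons, if_pos ((hJ g hg).2 hwin), mul_one, hωneg g hg, hε g hg]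
        push_cast; ring
      rw [Finset.sum_congr rfl hterm, ← Finset.mul_sum, ← Int.cast_sum,
        sum_normSign_one_add_mul_normSign_add_eq_zero_of_subBreak hD h2 hs1 hsd hwin hσc hvδ S hS1 hS2 hS3]
      simp
    · have hterm : ∀ g ∈ S, (((![normSign σ g * normSign σ (g * ((ϖ * σ ϖ) ^ ρ * eA) + (ϖ * σ ϖ) ^ ρ * eB) * (if 2 * d - 1 ≤ ρ then 1 else 0),
             normSign σ (g * ((ϖ * σ ϖ) ^ ρ * eA) + (ϖ * σ ϖ) ^ ρ * eB) * (if 2 * d - 1 ≤ ρ then 1 else 0),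
             normSign σ (-(1 + g)) * normSign σ (g * ((ϖ * σ ϖ) ^ ρ * eA) + (ϖ * σ ϖ) ^ ρ * eB) *
               (if Valued.v ϖ ^ ρ * Valued.v ((ϖ * σ ϖ) ^ ρ * eB - (ϖ * σ ϖ) ^ ρ * eA) ≤
                   Valued.v ϖ ^ (2 * d - 1) * Valued.v (g * ((ϖ * σ ϖ) ^ ρ * eA) + (ϖ * σ ϖ) ^ ρ * eB) then 1 else 0)] : Fin 3 → ℤ) 2 : ℤ) : ℚ) / 2 * mass = 0 := by
        intro g hg
        simp only [cons_val_two, Nat.succ_eq_add_one, Nat.reduceAdd, tail_cons, head_cons, if_neg (fun h => hwin ((hJ g hg).1 h)), mul_zero, Int.cast_zero,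
          zero_div, zero_mul]
      rw [Finset.sum_congr rfl hterm]
      simp

/-! ## §2  SCHEMA — the binder `hZ` of ★ p862244 `hRest_of_heads` (= ★ p861984's `hZ₃`, ∀-closed, token-free) -/

/-- **THE SCHEMA `hZ` OF `hRest_of_heads`, CLOSED.**  At every complete ramified datum with finite residue field and `|2| < 1`, every element datum at the DERIVED threshold
`n0DerivedOfRecord d`, `T = diag(α, β, 1)`, on the shallow key `n₁ = n₂ < n₃`, `n₃ + 4 ≤ n₁ + 2d` and the locus `2ρ + ℓ₀ = n₁` (`ρ ≥ 1`): the clean-shell labelled-odd table of `H(ρ)`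
vanishes in every slot — ★ p862244's 4th binder `hZ` VERBATIM.  Proof: the two depth-`m` tokens exist (★ `exists_towerSign_of_mcOfRecord_le`, parities ★ `depth_mod_two_eq_of_isElementDatum`,
`mcOfRecord d ≤ n0DerivedOfRecord d ≤ n₁ = n₂`), then §1.
[cite: Kottwitz1986BaseChangeUnits, §1 pp. 240–241] [cite: Rogawski1990, §4.9 Prop. 4.9.1 (a)(b) p. 55, §4.10 p. 58] -/
theorem shallow₃_zero_schema :
    ∀ {K : Type} [Field K] [Valued K ℤᵐ⁰] [CompleteSpace K] [Fintype 𝓀[K]] (σ : K →+* K) (ϖ : K) (d t : ℕ),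
      Valued.v (2 : K) < 1 → IsRamifiedQuadraticDatum σ ϖ d t →
      ∀ (α β : K) (n₁ n₂ n₃ : ℕ), IsElementDatum σ ϖ (n0DerivedOfRecord d) α β n₁ n₂ n₃ →
      ∀ (T : GL (Fin 3) K), (T : Matrix (Fin 3) (Fin 3) K) = Matrix.diagonal ![α, β, 1] →
      n₁ = n₂ → n₁ < n₃ → n₃ + 4 ≤ n₁ + 2 * d → ∀ ρ : ℕ, 1 ≤ ρ → 2 * ρ + d % 2 = n₁ → ∀ i : Fin 3,
      ∑ᶠ M ∈ {M : Submodule 𝒪[K] (Fin 3 → K) | M ∈ stratum σ ϖ T ![2 * ρ, 2 * ρ, 2 * ρ] ∧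
          (LatticeInLevel ϖ (d % 2) (Matrix.diagonal ![α - 1, β - 1, 0]) M ∧ ¬ LatticeInLevel ϖ (d % 2 + 1) (Matrix.diagonal ![α - 1, β - 1, 0]) M ∧
            LatticeInLevel ϖ (mcOfRecord d) (Matrix.diagonal ![(α - 1) * (α - 1), (β - 1) * (β - 1), 0]) M)},
        (labelledOddCount σ ϖ 0 i (valueClassLabel σ ϖ (α - 1) (β - 1) (mstarOfRecord d) d) M : ℚ) /
          ((((unitStabilizer M).map (unitNormMap σ 3)).relIndex (fixedUnitTorus σ 3) : ℕ) : ℚ) = 0 := by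
  intro K _ _ _ _ σ ϖ d t h2 hD α β n₁ n₂ n₃ hE T hT h12 h13 hsh ρ hρ h2ρ i
  have hmcN : mcOfRecord d ≤ n0DerivedOfRecord d := mcOfRecord_le_n0DerivedOfRecord d
  have hmcv : mcOfRecord d = 2 * ((d % 2 + 2 * d - 1 + d) / 2) := rfl
  have hdN : d ≤ n0DerivedOfRecord d := by omega
  obtain ⟨hα, hβ, -, -, -, h₁, h₂, -, hN1, hN2, -⟩ := id hE
  obtain ⟨hp1, hp2, -⟩ := depth_mod_two_eq_of_isElementDatum hD hE hdN
  obtain ⟨eA, hσeA, heA1, heA⟩ := exists_towerSign_of_mcOfRecord_le hD hα h₂ hp2 (le_trans hmcN hN2)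
  obtain ⟨eB, hσeB, -, heB⟩ := exists_towerSign_of_mcOfRecord_le hD hβ h₁ hp1 (le_trans hmcN hN1)
  exact finsum_stratum_H_shell_labelledOdd_div_relIndex_eq_zero_of_shallow₃ hD h2 hE hmcN h12 h13 hsh T hT ρ hρ h2ρ hσeA heA1 hσeB heA heB i

end Summit.HodgeConjecture.HodgeConjecture.Cruxes.H413.F0P3cDyRamLabelledOddCoreHangingShallowSum

end
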